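import Mathlib.Tactic.DeriveFintype
import Literature.Computability.Complexity.Oracle
import Literature.Computability.Complexity.TM2Context
import Literature.Computability.Complexity.StringSwap
import Literature.Computability.Complexity.PairProjections
import Literature.Computability.Complexity.StackMachines
import HarnessLib

/-!
# `FP^O` is closed under polynomial-time pre- and post-processing (transcript model)

Trunk `CplxCore`, companion of `Oracle.lean` / `OracleProofs.lean`. In the transcript model of
oracle computation (`OracleAlg`: a polynomial-time *step function* mapping the input and the
answers received so far to the next query or the output; `FPRel O = FP^O`), we prove the
book-keeping closure property

* `Literature.Computability.Complexity.postPre_mem_FPRel` — **if `f ∈ FP^O` and `pre, post ∈ FP` then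
  `w ↦ post ⟨w, f (pre w)⟩ ∈ FP^O`**,

with the corollaries `comp_FP_mem_FPRel` (`f ∘ pre ∈ FP^O`) and `FP_comp_mem_FPRel`
(`post ∘ f ∈ FP^O`). This is the function-oracle, relativised form of Arora–Barak's Example 3.6 (2)
with Remark 3.8 ("polynomial-time computation before and after the oracle phase costs nothing"):
the composite oracle algorithm `M.prePost pre post` runs the algorithm `M` of `f` on `pre w`,
forwarding its queries unchanged, and applies `post` to the pair of the input and the output
(`OracleAlg.runAux_prePost`, `OracleAlg.queriesAux_prePost`); its round and query budget is
`q ∘ r` for the budget `q` of `M` and a length bound `|pre w| ≤ r(|w|)`.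

The one non-trivial point is that the composite *step function*
`(w, answers) ↦ [M.step (pre w) answers, with post ⟨w, ·⟩ applied to an output]` is polynomial-time
on the pair-coded (input, transcript) (`OracleAlg.IsPolyTime`). No Turing machine is programmed:
the step function is assembled (`OracleAlg.isPolyTime_prePost`) from the tree's `FinTM2` toolkit by
composition (`PolyTimeComputable.comp_holds`) of

1. the pair combinators `copyFn`, `mapFstFn`, `mapSndFn`, `swapFn` and the pairing projections
   (`StringCopy.lean`, `MapFstMachine.lean`, `StringSwap.lean`, `PairProjections.lean`), which
   produce `⟨⟨pre w, answers⟩, w⟩` from `⟨w, answers⟩`;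
2. the context combinator `PolyTimeComputable.firstField` (`TM2Context.lean`), which runs the
   step machine of `M` on the first field `⟨pre w, answers⟩` while the context `w` is parked, in
   the field format `field.map some ++ none :: context.map some` over the alphabet `Option Bool`;
   two finite-state transducers `PrePost.toField` / `PrePost.fromField` (`Transducers.lean`)
   translate between the pair format and the field format;
3. a final finite-state *selection* `PrePost.selT`: both continuations are computed
   (`post ⟨w, b⟩` on the payload `b` of the step result, whatever its tag), and the transducer
   reading the tag bit outputs either the query unchanged (tag `inl`) or the tagged
   post-processed output (tag `inr`) — a conditional realised without a branching machine.

## References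

* S. Arora, B. Barak, *Computational Complexity: A Modern Approach*, CUP 2009, §3.4 (oracle
  machines), Example 3.6 (2), Remark 3.8; §1.3 and Claim 1.6 (machine composition); §17.2
  (`FP^{#P}`).
* T. Baker, J. Gill, R. Solovay, *Relativizations of the P =? NP question*, SIAM J. Comput. 4
  (1975), §1.
-/

namespace Literature.Computability.Complexity

open _root_.Computability

/-! ### Transcript lemmas -/

namespace OracleAlg

variable {β : Type}

/-- Once a run has produced its output within `k` rounds, more fuel does not change the
transcript of queries. [Arora–Barak 2009, §3.4] [cite: AroraBarak2009, §3.4] -/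
theorem queriesAux_eq_of_runAux_eq_some (M : OracleAlg β) (O : Oracle) (x : List Bool)
    {k k' : ℕ} (hk : k ≤ k') {answers : List (List Bool)} {b : β}
    (h : M.runAux O x k answers = some b) :
    M.queriesAux O x k' answers = M.queriesAux O x k answers := by
  induction k generalizing k' answers with
  | zero => simp at h
  | succ k ih =>
    obtain ⟨k'', rfl⟩ := Nat.exists_eq_add_of_le hk
    rw [show k + 1 + k'' = (k + k'') + 1 by omega]
    rw [runAux_succ] at h
    unfold queriesAux
    cases hs : M.step x answers with
    | inl q =>
      rw [hs] at h
      simp only [ih (Nat.le_add_right k k'') h]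
    | inr b' => rfl

/-- Consequently the queries within any larger budget obey the bounds established for the
budget within which the output appears. [Arora–Barak 2009, §3.4] [cite: AroraBarak2009, §3.4] -/
theorem queries_eq_of_run_eq_some (M : OracleAlg β) (O : Oracle) (x : List Bool) {k k' : ℕ}
    (hk : k ≤ k') {b : β} (h : M.run O k x = some b) : M.queries O k' x = M.queries O k x :=
  M.queriesAux_eq_of_runAux_eq_some O x hk h

/-- **Pre- and post-processing an oracle algorithm.** `M.prePost pre post` runs `M` on `pre w`,
forwarding its queries, and outputs `post ⟨w, b⟩` when `M` outputs `b`. (Arora–Barak 2009,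
Example 3.6 (2) with Remark 3.8.) [cite: AroraBarak2009, §3.4 Example 3.6 (2) with Remark 3.8] -/
def prePost (M : OracleAlg (List Bool)) (pre post : List Bool → List Bool) :
    OracleAlg (List Bool) where
  step w answers :=
    match M.step (pre w) answers with
    | Sum.inl q => Sum.inl q
    | Sum.inr b => Sum.inr (post (boolPair w b))

/-- The step of the composite (definitional unfolding). [folklore] -/
theorem prePost_step (M : OracleAlg (List Bool)) (pre post : List Bool → List Bool)
    (w : List Bool) (answers : List (List Bool)) :
    (M.prePost pre post).step w answers =
      match M.step (pre w) answers with
      | Sum.inl q => Sum.inl q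
      | Sum.inr b => Sum.inr (post (boolPair w b)) :=
  rfl

/-- **Runs of the composite** are the runs of `M` on `pre w`, post-processed. [Arora–Barak 2009, §3.4 Example 3.6 (2)] [cite: AroraBarak2009, §3.4 Example 3.6 (2) with Remark 3.8] -/
theorem runAux_prePost (M : OracleAlg (List Bool)) (pre post : List Bool → List Bool)
    (O : Oracle) (w : List Bool) (k : ℕ) (answers : List (List Bool)) :
    (M.prePost pre post).runAux O w k answers =
      (M.runAux O (pre w) k answers).map fun b => post (boolPair w b) := by
  induction k generalizing answers with
  | zero => rfl
  | succ k ih =>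
    rw [runAux_succ, runAux_succ, prePost_step]
    cases M.step (pre w) answers with
    | inl q => exact ih _
    | inr b => rfl

/-- **Transcripts of the composite** are the transcripts of `M` on `pre w`. [Arora–Barak 2009, §3.4 Example 3.6 (2)] [cite: AroraBarak2009, §3.4 Example 3.6 (2) with Remark 3.8] -/
theorem queriesAux_prePost (M : OracleAlg (List Bool)) (pre post : List Bool → List Bool)
    (O : Oracle) (w : List Bool) (k : ℕ) (answers : List (List Bool)) :
    (M.prePost pre post).queriesAux O w k answers = M.queriesAux O (pre w) k answers := by
  induction k generalizing answers with
  | zero => rfl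
  | succ k ih =>
    unfold queriesAux
    rw [prePost_step]
    cases M.step (pre w) answers with
    | inl q => exact congrArg (List.cons q) (ih _)
    | inr b => rfl

end OracleAlg

/-! ### The transducers -/

namespace PrePost

/-- States of the pair-to-field transducer `toField`: pair reader (even position / first symbol
of a pair read), then copier. [folklore] -/
inductive TF
  | ev
  | od (b : Bool)
  | copy
  deriving DecidableEq, Fintype

/-- Transition of `toField`: a doubled bit `bb` becomes the data symbol `some b`, the separator
`01` becomes the terminator `none`, after which every symbol `c` becomes `some c`. [folklore] -/
def toFieldStep : TF → Bool → TF × List (Option Bool)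
  | .ev, b => (.od b, [])
  | .od b, b' => if b = b' then (.ev, [some b]) else (.copy, [none])
  | .copy, c => (.copy, [some c])

/-- **Pair format to field format**: `⟨U, w⟩ ↦ U.map some ++ none :: w.map some`
(`toField_eval`). [Arora–Barak 2009, §0.1 (pairing), §1.3] [cite: AroraBarak2009, §0.1] -/
def toField : FST TF Bool (Option Bool) where
  init := .ev
  step := toFieldStep
  front := fun _ => []
  keep := fun _ => true

/-- The transition of `toField` (definitional). [folklore] -/
@[simp] theorem toField_step (s : TF) (b : Bool) : toField.step s b = toFieldStep s b := rfl

/-- The copier of `toField`. [folklore] -/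
theorem toField_run_copy (w : List Bool) : (toField.run .copy w).2 = w.map some := by
  induction w with
  | nil => rfl
  | cons b w ih => simp [FST.run_cons, toFieldStep, ih]

/-- The pair reader of `toField`. [folklore] -/
theorem toField_run_ev (U w : List Bool) :
    (toField.run .ev (boolPair U w)).2 = U.map some ++ none :: w.map some := by
  induction U with
  | nil => simp [boolPair, FST.run_cons, toFieldStep, toField_run_copy]
  | cons b U ih =>
    have hc : boolPair (b :: U) w = b :: b :: boolPair U w := by simp [boolPair]
    rw [hc]
    simp [FST.run_cons, toFieldStep, ih]

/-- **`toField ⟨U, w⟩ = U.map some ++ none :: w.map some`.** [Arora–Barak 2009, §0.1] [cite: AroraBarak2009, §0.1] -/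
theorem toField_eval (U w : List Bool) :
    toField.eval (boolPair U w) = U.map some ++ none :: w.map some := by
  have he : toField.eval (boolPair U w) = (toField.run .ev (boolPair U w)).2 := by
    simp [FST.eval, toField]
  rw [he, toField_run_ev]

/-- States of the field-to-pair transducer `fromField`: doubling the field, then copying the
context. [folklore] -/
inductive FF
  | dbl
  | copy
  deriving DecidableEq, Fintype

/-- Transition of `fromField`: a data symbol `some c` of the field is doubled, the terminator
`none` becomes the separator `01`, after which `some c ↦ c` (and a stray `none` is dropped). [folklore] -/
def fromFieldStep : FF → Option Bool → FF × List Bool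
  | .dbl, some c => (.dbl, [c, c])
  | .dbl, none => (.copy, [false, true])
  | .copy, some c => (.copy, [c])
  | .copy, none => (.copy, [])

/-- **Field format to pair format**: `V.map some ++ none :: w.map some ↦ ⟨V, w⟩`
(`fromField_eval`). [Arora–Barak 2009, §0.1 (pairing), §1.3] [cite: AroraBarak2009, §0.1] -/
def fromField : FST FF (Option Bool) Bool where
  init := .dbl
  step := fromFieldStep
  front := fun _ => []
  keep := fun _ => true

/-- The transition of `fromField` (definitional). [folklore] -/
@[simp] theorem fromField_step (s : FF) (a : Option Bool) :
    fromField.step s a = fromFieldStep s a := rfl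

/-- The copier of `fromField`. [folklore] -/
theorem fromField_run_copy (w : List Bool) : (fromField.run .copy (w.map some)).2 = w := by
  induction w with
  | nil => rfl
  | cons b w ih => simp [FST.run_cons, fromFieldStep, ih]

/-- The doubling phase of `fromField`. [folklore] -/
theorem fromField_run_dbl (V w : List Bool) :
    (fromField.run .dbl (V.map some ++ none :: w.map some)).2 = boolPair V w := by
  induction V with
  | nil => simp [boolPair, FST.run_cons, fromFieldStep, fromField_run_copy]
  | cons c V ih =>
    have hc : boolPair (c :: V) w = c :: c :: boolPair V w := by simp [boolPair]
    rw [hc]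
    simp [FST.run_cons, fromFieldStep, ih]

/-- **`fromField (V.map some ++ none :: w.map some) = ⟨V, w⟩`.** [Arora–Barak 2009, §0.1] [cite: AroraBarak2009, §0.1] -/
theorem fromField_eval (V w : List Bool) :
    fromField.eval (V.map some ++ none :: w.map some) = boolPair V w := by
  have he : fromField.eval (V.map some ++ none :: w.map some) =
      (fromField.run .dbl (V.map some ++ none :: w.map some)).2 := by
    simp [FST.eval, fromField]
  rw [he, fromField_run_dbl]

/-- States of the tail transducer: before / after the first symbol. [folklore] -/
inductive TT
  | start
  | copy
  deriving DecidableEq, Fintype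

/-- Transition of `tailT`: drop the first symbol, copy the rest. [folklore] -/
def tailStep : TT → Bool → TT × List Bool
  | .start, _ => (.copy, [])
  | .copy, c => (.copy, [c])

/-- **The tail of a string** as a transduction (`tailT_eval_cons`). [folklore] -/
def tailT : FST TT Bool Bool where
  init := .start
  step := tailStep
  front := fun _ => []
  keep := fun _ => true

/-- The transition of `tailT` (definitional). [folklore] -/
@[simp] theorem tailT_step (s : TT) (b : Bool) : tailT.step s b = tailStep s b := rfl

/-- The copier of `tailT`. [folklore] -/
theorem tailT_run_copy (l : List Bool) : (tailT.run .copy l).2 = l := by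
  induction l with
  | nil => rfl
  | cons b l ih => simp [FST.run_cons, tailStep, ih]

/-- **`tailT (a :: l) = l`.** [folklore] -/
theorem tailT_eval_cons (a : Bool) (l : List Bool) : tailT.eval (a :: l) = l := by
  have he : tailT.eval (a :: l) = (tailT.run .start (a :: l)).2 := by simp [FST.eval, tailT]
  rw [he]
  simp [FST.run_cons, tailStep, tailT_run_copy]

/-- States of the selection transducer `selT`: read the tag, skip its second copy, then either
keep the (doubled) payload and drop the rest (`keepEv`/`keepOd`/`drain`), or skip the payload
and copy the rest (`skipEv`/`skipOd`/`copy`). [folklore] -/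
inductive Sel
  | s0
  | s1 (t : Bool)
  | keepEv
  | keepOd (b : Bool)
  | drain
  | skipEv
  | skipOd (b : Bool)
  | copy
  deriving DecidableEq, Fintype

/-- Transition of `selT` (see `Sel`). [folklore] -/
def selStep : Sel → Bool → Sel × List Bool
  | .s0, t => (.s1 t, [t])
  | .s1 t, _ => (if t then .skipEv else .keepEv, [])
  | .keepEv, b => (.keepOd b, [])
  | .keepOd b, b' => if b = b' then (.keepEv, [b]) else (.drain, [])
  | .drain, _ => (.drain, [])
  | .skipEv, b => (.skipOd b, [])
  | .skipOd b, b' => if b = b' then (.skipEv, []) else (.copy, [])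
  | .copy, c => (.copy, [c])

/-- **The selection transducer**: on `⟨t :: payload, R⟩` it outputs `0 :: payload` if the tag
`t` is `0` and `1 :: R` if the tag is `1` (`selT_eval_false`, `selT_eval_true`) — the
conditional "forward the query, or post-process the output" of the composite step function,
with both branches precomputed. [Arora–Barak 2009, §1.3 (finite control)] [cite: AroraBarak2009, §1.3] -/
def selT : FST Sel Bool Bool where
  init := .s0
  step := selStep
  front := fun _ => []
  keep := fun _ => true

/-- The transition of `selT` (definitional). [folklore] -/
@[simp] theorem selT_step (s : Sel) (b : Bool) : selT.step s b = selStep s b := rfl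

/-- The absorbing state of `selT` emits nothing. [folklore] -/
theorem selT_run_drain (l : List Bool) : (selT.run .drain l).2 = [] := by
  induction l with
  | nil => rfl
  | cons b l ih => simp [FST.run_cons, selStep, ih]

/-- The copier of `selT`. [folklore] -/
theorem selT_run_copy (l : List Bool) : (selT.run .copy l).2 = l := by
  induction l with
  | nil => rfl
  | cons b l ih => simp [FST.run_cons, selStep, ih]

/-- Keeping the payload: from `keepEv` on `⟨payload, R⟩` the transducer emits `payload`. [folklore] -/
theorem selT_run_keepEv (payload R : List Bool) :
    (selT.run .keepEv (boolPair payload R)).2 = payload := by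
  induction payload with
  | nil => simp [boolPair, FST.run_cons, selStep, selT_run_drain]
  | cons b payload ih =>
    have hc : boolPair (b :: payload) R = b :: b :: boolPair payload R := by simp [boolPair]
    rw [hc]
    simp [FST.run_cons, selStep, ih]

/-- Skipping the payload: from `skipEv` on `⟨payload, R⟩` the transducer emits `R`. [folklore] -/
theorem selT_run_skipEv (payload R : List Bool) :
    (selT.run .skipEv (boolPair payload R)).2 = R := by
  induction payload with
  | nil => simp [boolPair, FST.run_cons, selStep, selT_run_copy]
  | cons b payload ih =>
    have hc : boolPair (b :: payload) R = b :: b :: boolPair payload R := by simp [boolPair]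
    rw [hc]
    simp [FST.run_cons, selStep, ih]

/-- **Selection, tag `0`**: `selT ⟨0 :: payload, R⟩ = 0 :: payload`. [Arora–Barak 2009, §1.3] [cite: AroraBarak2009, §1.3] -/
theorem selT_eval_false (payload R : List Bool) :
    selT.eval (boolPair (false :: payload) R) = false :: payload := by
  have he : ∀ l, selT.eval l = (selT.run .s0 l).2 := fun l => by simp [FST.eval, selT]
  have hc : boolPair (false :: payload) R = false :: false :: boolPair payload R := by
    simp [boolPair]
  rw [he, hc]
  simp [FST.run_cons, selStep, selT_run_keepEv]

/-- **Selection, tag `1`**: `selT ⟨1 :: payload, R⟩ = 1 :: R`. [Arora–Barak 2009, §1.3] [cite: AroraBarak2009, §1.3] -/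
theorem selT_eval_true (payload R : List Bool) :
    selT.eval (boolPair (true :: payload) R) = true :: R := by
  have he : ∀ l, selT.eval l = (selT.run .s0 l).2 := fun l => by simp [FST.eval, selT]
  have hc : boolPair (true :: payload) R = true :: true :: boolPair payload R := by
    simp [boolPair]
  rw [he, hc]
  simp [FST.run_cons, selStep, selT_run_skipEv]

end PrePost

/-! ### The composite step function is polynomial-time -/

namespace OracleAlg

open PrePost

/-- Encoding of the arguments `(input, answers so far)` of a step function, as in
`OracleAlg.IsPolyTime`: `boolPair x (listBool answers)`. [Arora–Barak 2009, §3.4] [cite: AroraBarak2009, §3.4] -/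
def encIn (p : List Bool × List (List Bool)) : List Bool :=
  boolPair p.1 ((encodingList Bool).listBool.encode p.2)

/-- Encoding of step results `List Bool ⊕ List Bool` (query / output) with a tag bit, as in
`OracleAlg.IsPolyTime`. [Arora–Barak 2009, §3.4] [cite: AroraBarak2009, §3.4] -/
def encOut (r : List Bool ⊕ List Bool) : List Bool :=
  ((encodingList Bool).sumBool (encodingList Bool)).encode r

/-- `encOut (inl q) = 0q` (definitional). [folklore] -/
@[simp] theorem encOut_inl (q : List Bool) : encOut (Sum.inl q) = false :: q := rfl

/-- `encOut (inr b) = 1b` (definitional). [folklore] -/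
@[simp] theorem encOut_inr (b : List Bool) : encOut (Sum.inr b) = true :: b := rfl

/-- Field encoding of (step arguments, context): `(encIn a).map some ++ none :: w.map some`. [folklore] -/
def enc1 (q : (List Bool × List (List Bool)) × List Bool) : List (Option Bool) :=
  (encIn q.1).map some ++ none :: q.2.map some

/-- Field encoding of (step result, context): `(encOut r).map some ++ none :: w.map some`. [folklore] -/
def enc2 (q : (List Bool ⊕ List Bool) × List Bool) : List (Option Bool) :=
  (encOut q.1).map some ++ none :: q.2.map some

/-- Stage 1 of the composite step: `(w, answers) ↦ ((pre w, answers), w)`. [folklore] -/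
def stage1 (pre : List Bool → List Bool) (p : List Bool × List (List Bool)) :
    (List Bool × List (List Bool)) × List Bool :=
  ((pre p.1, p.2), p.1)

/-- Stage 2 of the composite step: the step of `M` on the first field, context kept. [folklore] -/
def stage2 (M : OracleAlg (List Bool)) :
    (List Bool × List (List Bool)) × List Bool → (List Bool ⊕ List Bool) × List Bool :=
  Prod.map (Function.uncurry M.step) id

/-- Stage 3 of the composite step: forward a query, post-process an output with the context. [folklore] -/
def stage3 (post : List Bool → List Bool) (q : (List Bool ⊕ List Bool) × List Bool) :
    List Bool ⊕ List Bool :=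
  match q.1 with
  | Sum.inl y => Sum.inl y
  | Sum.inr b => Sum.inr (post (boolPair q.2 b))

/-- The composite step function factors through the three stages. [folklore] -/
theorem uncurry_prePost_step (M : OracleAlg (List Bool)) (pre post : List Bool → List Bool) :
    Function.uncurry (M.prePost pre post).step = stage3 post ∘ stage2 M ∘ stage1 pre := by
  funext p
  obtain ⟨w, as⟩ := p
  simp only [Function.uncurry_apply_pair, Function.comp_apply, stage1, stage2, stage3,
    Prod.map_apply, id, prePost_step]

/-- **Stage 1 is polynomial-time**: `⟨w, A⟩ ↦ ⟨⟨w, A⟩, ⟨w, A⟩⟩ ↦ ⟨⟨pre w, A⟩, w⟩` by the pair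
combinators, then `toField`. [Arora–Barak 2009, §1.3, Claim 1.6] [cite: AroraBarak2009, §1.3 and Claim 1.6] -/
theorem polyTime_stage1 {pre : List Bool → List Bool} (hpre : pre ∈ FP) :
    PolyTimeComputable encIn enc1 (stage1 pre) := by
  have hfst : (fun z : List Bool => (boolUnpair z).1) ∈ FP := boolUnpairFst_mem_FP
  have hW : (mapSndFn (fun z : List Bool => (boolUnpair z).1) ∘ mapFstFn (mapFstFn pre) ∘ copyFn) ∈ FP :=
    comp_mem_FP (mapSndFn_mem_FP hfst)
      (comp_mem_FP (mapFstFn_mem_FP (mapFstFn_mem_FP hpre)) copyFn_mem_FP)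
  have hS : PolyTimeComputable (id : List Bool → List Bool) (id : List (Option Bool) → _)
      (toField.eval ∘ mapSndFn (fun z : List Bool => (boolUnpair z).1) ∘
        mapFstFn (mapFstFn pre) ∘ copyFn) :=
    PolyTimeComputable.comp_holds toField.polyTimeComputable_eval hW
  refine PolyTimeComputable.of_encode hS encIn (fun _ => rfl) fun p => ?_
  obtain ⟨w, as⟩ := p
  simp only [id, Function.comp_apply, encIn, enc1, stage1, copyFn_apply, mapFstFn_boolPair,
    mapSndFn_boolPair, boolUnpair_boolPair, toField_eval]

/-- **Stage 2 is polynomial-time**: `PolyTimeComputable.firstField` applied to the step machine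
of `M`. [Arora–Barak 2009, §1.3 (subroutines)] [cite: AroraBarak2009, §1.3 and Claim 1.6] -/
theorem polyTime_stage2 {M : OracleAlg (List Bool)} (hM : M.IsPolyTime (encodingList Bool)) :
    PolyTimeComputable enc1 enc2 (stage2 M) :=
  PolyTimeComputable.firstField (fun w : List Bool => w.map some) hM

/-- **Stage 3 is polynomial-time**: `fromField`, then `⟨P, P⟩ ↦ ⟨P, post ⟨w, payload⟩⟩ ↦
⟨tag :: payload, post ⟨w, payload⟩⟩` by the pair combinators (`P = ⟨tag :: payload, w⟩`), then
the selection `selT`. [Arora–Barak 2009, §1.3, Claim 1.6] [cite: AroraBarak2009, §1.3 and Claim 1.6] -/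
theorem polyTime_stage3 {post : List Bool → List Bool} (hpost : post ∈ FP) :
    PolyTimeComputable enc2 encOut (stage3 post) := by
  have hfst : (fun z : List Bool => (boolUnpair z).1) ∈ FP := boolUnpairFst_mem_FP
  have hH : (post ∘ swapFn ∘ mapFstFn tailT.eval) ∈ FP :=
    comp_mem_FP hpost (comp_mem_FP swapFn_mem_FP (mapFstFn_mem_FP tailT.polyTimeComputable_eval))
  have hW : (mapFstFn (fun z : List Bool => (boolUnpair z).1) ∘
      mapSndFn (post ∘ swapFn ∘ mapFstFn tailT.eval) ∘ copyFn) ∈ FP :=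
    comp_mem_FP (mapFstFn_mem_FP hfst) (comp_mem_FP (mapSndFn_mem_FP hH) copyFn_mem_FP)
  have hS : PolyTimeComputable (id : List (Option Bool) → _) (id : List Bool → List Bool)
      ((selT.eval ∘ mapFstFn (fun z : List Bool => (boolUnpair z).1) ∘
        mapSndFn (post ∘ swapFn ∘ mapFstFn tailT.eval) ∘ copyFn) ∘ fromField.eval) :=
    PolyTimeComputable.comp_holds
      (PolyTimeComputable.comp_holds selT.polyTimeComputable_eval hW)
      fromField.polyTimeComputable_eval
  refine PolyTimeComputable.of_encode hS enc2 (fun _ => rfl) fun q => ?_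
  obtain ⟨r, w⟩ := q
  cases r with
  | inl y =>
    simp only [id, Function.comp_apply, enc2, stage3, encOut_inl, fromField_eval, copyFn_apply,
      mapSndFn_boolPair, mapFstFn_boolPair, boolUnpair_boolPair, selT_eval_false]
  | inr b =>
    simp only [id, Function.comp_apply, enc2, stage3, encOut_inr, fromField_eval, copyFn_apply,
      mapSndFn_boolPair, mapFstFn_boolPair, boolUnpair_boolPair, tailT_eval_cons, swapFn_boolPair,
      selT_eval_true]

/-- **The step function of `M.prePost pre post` is polynomial-time** for `M` polynomial-time and
`pre, post ∈ FP`: it factors as (pair combinators and `toField`) ▸ (`firstField` of the step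
machine of `M`, context `w`) ▸ (`fromField`, both continuations, `selT`), see the module
docstring. [Arora–Barak 2009, §3.4 Example 3.6 (2) with §1.3, Claim 1.6] [cite: AroraBarak2009, §3.4 Example 3.6 (2) with Remark 3.8] -/
theorem isPolyTime_prePost {M : OracleAlg (List Bool)} {pre post : List Bool → List Bool}
    (hM : M.IsPolyTime (encodingList Bool)) (hpre : pre ∈ FP) (hpost : post ∈ FP) :
    (M.prePost pre post).IsPolyTime (encodingList Bool) := by
  unfold IsPolyTime
  rw [uncurry_prePost_step]
  exact PolyTimeComputable.comp_holds (polyTime_stage3 hpost)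
    (PolyTimeComputable.comp_holds (polyTime_stage2 hM) (polyTime_stage1 hpre))

end OracleAlg

/-! ### `FP^O` is closed under `FP` pre- and post-processing -/

/-- **`f ∈ FP^O`, `pre, post ∈ FP` ⟹ `w ↦ post ⟨w, f (pre w)⟩ ∈ FP^O`** (transcript model of
`Oracle.lean`): the composite algorithm `M.prePost pre post` has a polynomial-time step function
(`OracleAlg.isPolyTime_prePost`), produces `post ⟨w, f (pre w)⟩` within `q(|pre w|) ≤ (q ∘ r)(|w|)`
rounds (`OracleAlg.runAux_prePost`, `OracleAlg.run_mono`) and asks exactly the queries of `M` on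
`pre w` (`OracleAlg.queriesAux_prePost`, `OracleAlg.queriesAux_eq_of_runAux_eq_some`), of length
`≤ q(|pre w|)`. (Arora–Barak 2009, §3.4, Example 3.6 (2) with Remark 3.8, relativised and for
function oracles.) [cite: AroraBarak2009, §3.4 Example 3.6 (2) with Remark 3.8] -/
theorem postPre_mem_FPRel {O : Oracle} {f pre post : List Bool → List Bool} (hf : f ∈ FPRel O)
    (hpre : pre ∈ FP) (hpost : post ∈ FP) :
    (fun w => post (boolPair w (f (pre w)))) ∈ FPRel O := by
  obtain ⟨M, hM, q, hq⟩ := hf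
  -- `|pre w| ≤ r(|w|)` for a polynomial `r` (`OutputsWithin.length_le`; this is
  -- `exists_poly_length_le_of_mem_FP` of `CountingHierarchyProofs.lean`, not imported here)
  obtain ⟨r, hr⟩ : ∃ r : Polynomial ℕ, ∀ x, (pre x).length ≤ r.eval x.length := by
    obtain ⟨p, Mp, hMp⟩ := hpre
    refine ⟨Polynomial.X + Polynomial.C (TM2Comp.machinePushBound Mp.tm) * p, fun x => ?_⟩
    have h := (hMp x).length_le
    simpa using h
  refine ⟨M.prePost pre post, OracleAlg.isPolyTime_prePost hM hpre hpost, q.comp r, fun w => ?_⟩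
  obtain ⟨hrun, hqs⟩ := hq (pre w)
  have hle : q.eval (pre w).length ≤ (q.comp r).eval w.length := by
    rw [Polynomial.eval_comp]
    exact TM2Iter.eval_mono q (hr w)
  have hrun' : (M.prePost pre post).run O (q.eval (pre w).length) w =
      some (post (boolPair w (f (pre w)))) := by
    change (M.prePost pre post).runAux O w _ [] = _
    rw [OracleAlg.runAux_prePost]
    change (M.run O (q.eval (pre w).length) (pre w)).map _ = _
    rw [hrun]
    rfl
  refine ⟨OracleAlg.run_mono _ O w hle hrun', fun y hy => ?_⟩
  have hy' : y ∈ M.queries O (q.eval (pre w).length) (pre w) := by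
    have hQ : (M.prePost pre post).queries O ((q.comp r).eval w.length) w =
        M.queries O (q.eval (pre w).length) (pre w) := by
      change (M.prePost pre post).queriesAux O w _ [] = _
      rw [OracleAlg.queriesAux_prePost]
      exact M.queriesAux_eq_of_runAux_eq_some O (pre w) hle hrun
    rwa [hQ] at hy
  exact (hqs y hy').trans hle

/-- **`FP^O ∘ FP ⊆ FP^O`**: `f ∈ FP^O`, `pre ∈ FP` ⟹ `f ∘ pre ∈ FP^O` (post-process with the
second projection). [Arora–Barak 2009, §3.4 Example 3.6 (2)] [cite: AroraBarak2009, §3.4 Example 3.6 (2) with Remark 3.8] -/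
theorem comp_FP_mem_FPRel {O : Oracle} {f pre : List Bool → List Bool} (hf : f ∈ FPRel O)
    (hpre : pre ∈ FP) : f ∘ pre ∈ FPRel O := by
  have h := postPre_mem_FPRel hf hpre boolUnpairSnd_mem_FP
  simp only [boolUnpair_boolPair] at h
  exact h

/-- **`FP ∘ FP^O ⊆ FP^O`**: `f ∈ FP^O`, `post ∈ FP` ⟹ `post ∘ f ∈ FP^O` (pre-process with the
identity, post-process with `post` after the second projection). [Arora–Barak 2009, §3.4 Example 3.6 (2)] [cite: AroraBarak2009, §3.4 Example 3.6 (2) with Remark 3.8] -/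
theorem FP_comp_mem_FPRel {O : Oracle} {f post : List Bool → List Bool} (hf : f ∈ FPRel O)
    (hpost : post ∈ FP) : post ∘ f ∈ FPRel O := by
  have hid : (id : List Bool → List Bool) ∈ FP := PolyTimeComputable.id _
  have h := postPre_mem_FPRel hf hid (comp_mem_FP hpost boolUnpairSnd_mem_FP)
  simp only [Function.comp_apply, boolUnpair_boolPair, id] at h
  exact h

end Literature.Computability.Complexity
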